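import Mathlib
import HarnessLib
import HarnessLib.Audit
import Summits.QuantumFields.Statement
import Summits.QuantumFields.YangMills.Theorems.WeakCouplingRates
import Literature.MathematicalPhysics.QuantumLattice.LatticeGaugeDLR
import Literature.MathematicalPhysics.QuantumLattice.WilsonLoops
import Summits.QuantumFields.YangMills.Theorems.SoftLoopLongLagSoftLoopObsPosTime
import HarnessLib.Audit.Status.Attr

/-!
Route: SoftLoopVariational

# Route SoftLoopVariational — variational soft-loop Rayleigh quotient forces xi >= beta^eps for all
compact simple G

It suffices to show X = T ∧ K_red (∧ the provable-now support P): (T, ColdBoxSoftLoopRatio) in ONE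
perturbative unit — the DLR kernel of the 4-D Wilson theory in the box of half-side ⌈β^(4ε)⌉
conditioned on the cold event «every plaquette touching the box costs ≤ β^(κ−1)», for every exterior
giving that event kernel-probability ≥ 1/2 — the cube-smeared soft-loop observable F = Σ_(x ∈
box(R), x₀=0) N⁻¹ Re tr ρ(R×R spatial loop at x), R = ⌈β^ε⌉, has variance ≥ β^(−q) and two-step
Rayleigh numerator E(F∘α₂ − F)² ≤ C β^(−ε) Var F; (K_red, SoftLoopRatioOfColdBox) T transfers to
EVERY torus-limit state μ as 0 < rpCorr μ F 2 and rpCorr μ F 0 ≤ exp(2β^(−ε)) rpCorr μ F 2 (DLR +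
law of total variance + chessboard typicality of the cold event); (P) F is a positive-time
observable. Then the RP-spectral gap m of μ obeys m ≤ ½ log(rpCorr F 0 / rpCorr F 2) ≤ β^(−ε): the
leaf XiPow (ξ ≥ β^ε, all compact simple G). HONEST LABEL: the registered rung R2ξ `XiPowSU2` (SU(2))
is ALREADY CLOSED in the tree (`xiPowSU2_holds`, 2026-08-27); the content of this line is the
strictly stronger, still OPEN all-G leaf `XiPow` — the deciding theorem proves `XiPow` from the
three items (kernel-checked) and only then specialises by the tree's `xiPowSU2_of_xiPow`; it is
filed under closes_target R2ξ solely because `XiPow` is not yet a registered closer (request «to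
director-ym» 2026-08-27T20:2xZ to register R2ξ′ := XiPow and re-point this route). bears_on: R2ξ′
(XiPow, all compact simple G). It proves no summit and is NOT the Clay gap (an UPPER bound on the
gap).
Lean: `ColdBoxSoftLoopRatio ∧ SoftLoopRatioOfColdBox ∧ SoftLoopObsPosTime`

## Assembly
The deciding theorem `closes (hA : Assembly) (hT) (hK) (hP) : XiPowSU2 := xiPowSU2_of_xiPow (hA hT
hK hP)` consumes every item; the mathematical glue is the Assembly item, PROVABLE NOW and
kernel-checked in the seat's Sketch.lean (`assembly_holds`, 15 lines): K_red applied to T gives, for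
β ≥ max(β₀,1) and every torus-limit state μ, 0 < δ := rpCorr μ F 2 and rpCorr μ F 0 ≤
exp(2β^(−ε))·δ; P makes F admissible in `HasRPTimeGap`; the landed variational kernel
`HasRPTimeGap.le_log_div` (t = 2) gives m ≤ log(exp(2β^(−ε))·δ/δ)/2 = β^(−ε), i.e.
`MassGapPowerDecayOf 4 r.ρ ε` for every G, r — the leaf `XiPow`; `xiPowSU2_of_xiPow` specialises to
the registered (closed) leaf. Lean proof of Assembly for the prover: `intro hT hK hP G _ _ _ _ hG;
letI : MeasurableSpace G := borel G; haveI : BorelSpace G := ⟨rfl⟩; intro r; obtain ⟨ε, β₀, hε, h⟩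
:= hK hT G hG r; refine ⟨ε, hε, max β₀ 1, fun β hβ μ hμ m hm => ?_⟩; obtain ⟨hpos, hle⟩ := h β
((le_max_left _ _).trans hβ) μ hμ; have key := HasRPTimeGap.le_log_div hm (hP G r ⌈β ^ ε⌉₊) (t := 2)
(by norm_num) hpos le_rfl hle; rw [mul_div_assoc, div_self (ne_of_gt hpos), mul_one, Real.log_exp]
at key; (2β^(−ε)/2 = β^(−ε))`. Not the Statement of the summit; a rung line.

CLOSES_TARGET: closes rung R2xi of QuantumFields: Summit.QuantumFields.YangMills.Theorems.WeakCouplingRates.XiPowSU2 (D-0061; not the summit Statement) — the deciding theorem of this route concludes that registered leaf instead of the Statement decl `YangMills` (class rung: servable and labelled, never counted as concluding the summit Statement).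

Rationale: WHY THIS LINE. Technique card «probabilistic model → deterministic statement»: the deterministic
statement (an upper bound on the transfer-matrix gap of every infinite-volume state) is obtained
from ONE trial vector in the OS Hilbert space — the variational principle of lattice glueball
spectroscopy (effective masses from smeared operators are UPPER bounds on the true mass;
Berg–Billoire / APE smearing, Montvay–Münster 1994 §3.6 p.162, §5.1 pp.255–257) turned into a
theorem: `HasRPTimeGap.le_log_div` at t = 2 needs only a LOWER bound on the ratio rpCorr F 2 /
rpCorr F 0 for one positive-time F. Smearing the R×R loop over (2R+1)³ base points makes the
collective flux mode (free-gluon flux–flux correlations O(1) at distance R, decorrelating in time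
only on scale R) dominate the variance (≍ R⁶/β²) while the fast perimeter/UV self-energy
fluctuations contribute only R⁵/β², so the quotient is 1 − O(1/R) = 1 − O(β^(−ε)) in the Gaussian
regime (T, one cold box, lattice perturbation theory à la Hattori–Kawai 1981 / Müller–Rühl 1981).
Infinite volume enters ONLY through K_red: by DLR (tree fact
`mem_ymGibbsMeasures_of_mem_infiniteVolumeLimitPoints`, landed) E_μ(F∘α₂−F)² = E_η E_(γ(η))(…) and
by the law of total variance Var_μ F ≥ E_η Var_(γ(η)) F ≥ E_η[γ(η)(cold)·Var_(ν_η) F] — uncontrolled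
slow backgrounds imposed by the exterior can only RAISE the quotient's denominator, never spoil the
bound — and the cold event is typical uniformly over torus-limit states by chessboard exponential
moments + the free-energy log coefficient (tree: `freeEnergyLogCoefficient_proof`,
`abs_le_exp_of_chessboard`). What it does that listed routes do not: route WeakCouplingRates (leaf
XiPowSU2, closed today by `xiPowSU2_holds`) needs BULK domination of the CONNECTED plaquette
two-point function of torus states by the cold-box one (an RG-class comparison of signed covariances
at separation β^A); here no connected correlator of the infinite-volume state is ever compared —
only a variance is bounded BELOW by conditioning (monotone) and a positive functional is averaged
(exact DLR); DirichletWindow / EquipartitionCriticality need unconditional fixed-distance or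
variance control of μ itself. The statement is G-uniform (no SU(2) one-link structure), so it bears
on the all-G leaf XiPow.

RANKED CRUXES. #2 ColdBoxSoftLoopRatio (crux) — (T) for every compact simple G and faithful unitary
r there are ε, κ ∈ (0,1), q, C, β₀ such that for β ≥ β₀ and every exterior η whose DLR kernel on the
box of half-side ⌈β^(4ε)⌉ gives the cold event (all plaquettes touching the box cost ≤ β^(κ−1))
probability ≥ 1/2, the cold-conditioned kernel ν satisfies β^(−q) ≤ Var_ν F and ∫ (F∘α₂ − F)² dν ≤ C
β^(−ε) Var_ν F for the cube-smeared R×R soft-loop observable F, R = ⌈β^ε⌉. [difficulty: L] (why it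
might fail: one perturbative unit only if box⁴·β^(−1/2) ≪ 1 (ε < 1/32); a strained boundary layer
(exterior only near-pure-gauge) may shift the flux–flux covariance at scale R by more than relative
β^(−ε); perimeter R⁵/β² vs collective R⁶/β² is only a 1/R margin.)
[doi:10.1016/0370-2693(81)90037-x, ChatterjeeYMProb2019, doi:10.1017/cbo9780511470783]
#3 SoftLoopRatioOfColdBox (crux) — (K_red) T ⇒ for every compact simple G, faithful r, there are ε,
β₀ with: for β ≥ β₀ and every torus-limit state μ at coupling β, 0 < rpCorr μ F 2 and rpCorr μ F 0 ≤
exp(2β^(−ε)) · rpCorr μ F 2 for the same soft-loop observable F (R = ⌈β^ε⌉) — via DLR for limit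
points, the law of total variance over the exterior, chessboard typicality of the cold event and
time-translation invariance of torus-limit states. [deps: ColdBoxSoftLoopRatio] [difficulty: M] (why
it might fail: needs cold-event typicality UNIFORM over torus-limit states (chessboard plaquette
moments passed to weak limits for a closed cylinder event) and exact time-translation invariance of
every limit point; junk e^(−cβ^κ)·poly(β) vs floor β^(−q) fails if q must grow with 1/κ.)
[ChatterjeeYMProb2019, doi:10.1214/24-aop1702, FILS1978]
#9 SoftLoopObsPosTime (support) — (P) for every G, r, R the cube-smeared R×R spatial soft-loop
observable based in the time-zero slice is a positive-time observable (bounded continuous cylinder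
function on edges with x₀ ≥ 0): continuity of `walkHolonomy`/`wilsonLoopObs`, |χ| ≤ 1 for the
normalised character of a unitary representation, cylinder on the edges of `rectWalk x 1 2 R R` (all
at time x₀ = 0). [difficulty: provable-now] [Seiler1982]

TWO-LAYER PLAN. T ⇐ T1 → T2 → T: T1 (Gaussian core) the two inequalities for the lattice-Maxwell
(dim G copies) Gaussian measure of the gauge-fixed box with the explicit flux–flux kernel (perimeter
R⁵/β² vs collective R⁶/β²); T2 (anharmonic + boundary-strain remainder) relative error ≤
β^(−1/2+16ε+κ') for both moments under the cold-conditioned kernel, uniformly over admissible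
exteriors. K_red ⇐ K1 (cold typicality uniform over torus-limit states, chessboard) → K2
(DLR/total-variance bookkeeping) → K_red.

KILL CRITERIA. Refuted: T (a cold box + admissible exterior where the two-step numerator is ≥ c·Var
F with c independent of β — e.g. if the perimeter self-energy fluctuation of the smeared loop is NOT
subdominant) closes the route `refuted:ColdBoxSoftLoopRatio`; a refutation of K_red with T standing
forces a pivot to a torus-state (no-DLR) version of T on the full torus of side β^(4ε)
(finite-volume states only, weaker leaf). XiPow proved elsewhere (e.g. by generalising BOX_W/BULK_W
of WeakCouplingRates to all G) moots the line.

NOT DECOMPOSED YET. The Gaussian flux–flux kernel asymptotics (constants in R⁶/β² and R⁵/β²), the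
gauge-fixing chart (axial tree, `LatticeAxialGauge`), the large-field/typicality constants (which κ,
which q), and the passage of chessboard bounds to weak limits are layer-2 children; ε is left
existential (any ε < 1/40 should do).

CHEAPEST FALSIFIER. Compute, in free lattice Maxwell theory on ℤ⁴ (one scalar photon suffices), V(R)
= Var(Σ_(x∈box R, x₀=0) Φ_x²) and D(R) = E(Σ_x (Φ_(x+2e₀)² − Φ_x²))² for the R×R flux Φ_x, R =
2..12: the line needs D(R)/V(R) → 0 like 1/R (Wick: both are sums of squared flux–flux covariances).
If D/V stays O(1) (perimeter term dominant) T is dead. A kit job of a few core-minutes (lattice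
Green function sums); not yet run this session.

NUMBERS. ε: free (need (2⌈β^(4ε)⌉+1)⁴·β^(−1/2) ≪ 1, so ε < 1/32); κ ∈ (0,1) free; prediction m(β) ≍
β^(c₁) e^(−c₂β) (asymptotic freedom) so XiPow is far from sharp. Var F ≍ R⁶/β² (collective) + R⁵/β²
(perimeter); E(F∘α₂−F)² ≍ R⁵/β² + R⁴/β².

DEFINITION REQUESTS. None: all notions exist (`ymSpecification`, `plaquettesTouching`,
`plaquetteObs`, `wilsonLoopObs`, `rectWalk`, `rpCorr`, `IsPosTimeObs`, `timeShiftLG`,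
`infiniteVolumeLimitPoints`, `ProbabilityTheory.cond`, `ProbabilityTheory.variance`).

Novelty: Searches (2026-08-27): lit search --hybrid "variational upper bound glueball mass smeared Wilson
loop operators effective mass lattice gauge" (6 docs:
[corpus:book:montvay1994-quantum-fields-lattice p.162, pp.255–257] glueball mass estimates and
smearing — numerical variational method, no theorem on ξ(β)); lit vsearch "<mass gap bounded above
by inverse power of beta … trial observable and reflection positivity>" (6 docs, same books, nothing
rigorous); lit galaxy search "smeared Wilson loop|variational estimate of the mass gap|correlation
length diverges" --star all (16 rows, none relevant: no hits in galaxy); lit search … --source all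
(crossref: [graph:doi:10.1214/24-aop1702] Adhikari–Cao finite G — opposite regime;
[graph:doi:10.1016/0370-2693(81)90037-x] Hattori–Kawai weak-coupling PT of Wilson loops); tree:
`lean`-read of Theses WeakCouplingRates / DirichletWindow / EquipartitionCriticality /
XiCompleteMonotonicity / ThermalRuler and `ledger negatives --problem QuantumFields` (7, none on
rates).
Nearest prior art found: route-QuantumFields-WeakCouplingRates (`xiPowSU2_holds`: cold-box PT for
the plaquette two-point function + BULK domination, SU(2)); ChatterjeeYMProb2019 Problem 5.1; the
numerical variational/smearing principle [corpus:book:montvay1994-quantum-fields-lattice p.162].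
Delta: the numerical variational principle «effective mass of a smeared operator bounds the gap from
above» becomes a proof architecture for ξ ≥ β^ε for ALL compact simple G in which the infin  [refs: 10.1214/24-aop1702, 10.1016/0370-2693(81, book:montvay1994-quantum-fields-lattice, doi:10.1214/24-aop1702, doi:10.1016/0370-2693, ChatterjeeYMProb2019]

Barriers (technique_class: variational-trial-state, dlr-conditioning, lattice-pt): - technique_class: variational-trial-state, dlr-conditioning, lattice-pt
- Literature.Barriers.QuantumFields.DiluteInstantonGasDivergence: not applicable — no
semiclassical/instanton sum is used; the only expansion is Gaussian + bounded anharmonic remainder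
in ONE cold box of polynomial size, where the dilute-gas divergence (an infinite-volume, all-scales
statement) does not arise. (Uncatalogued but relevant: discrete-subgroup freezing, file
Literature/Barriers/QuantumFields/DiscreteSubgroupFreezing.lean `actionGap_pos_of_finite` — finite G
have bounded ξ; the leaf and T quantify over compact simple LIE groups only, whose continuum of
near-flat configurations is what T's Gaussian regime uses.)
- Literature.Barriers.QuantumFields.ElitzurTheorem: outside — every observable used (soft loops,
plaquette costs) is gauge-invariant; gauge fixing appears only inside the proof of T as a chart.
- Literature.Barriers.QuantumFields.AbelianDeconfinementD4: not applicable — the line claims an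
UPPER bound on the gap (criticality as β → ∞), which also holds for U(1) (massless Coulomb phase);
nothing here distinguishes confinement.
- Negatives index: none of the 7 refuted YangMills statements (CurvatureAnchor 15826,
SelfNormalisedSkewness 18944, RobustYangMillsRG 14958, DiagonalMirrorRP 9665, AdaptiveCoarseSystem
9494, MultibosonLatticeGap 9599, AdmissibleRootsExist 9603) concerns weak-coupling rates or
variational gap bounds; the line uses none of them.

History (route lifecycle, newest last):
- 2026-08-27T20:58:44Z · CLOSED superseded — superseded:route-QuantumFields-SoftLoopLongLag (planner-ym-idea-5-g0-0)

sub-problem: YangMills · status: draft · opened planner-ym-idea-5-g0-0 2026-08-27T20:36:18Z · rev 0 · ledger route-QuantumFields-SoftLoopVariational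
GENERATED by the gate from the ledger (D-0016/17). Provers cite these decls: `theorem foo : Summit.QuantumFields.YangMills.Theses.SoftLoopVariational.<Decl> := …` in Summits/QuantumFields/YangMills/Theorems/<Name>.lean.
-/

namespace Summit.QuantumFields.YangMills.Theses.SoftLoopVariational

open scoped BigOperators Topology Manifold Classical MeasureTheory ProbabilityTheory Matrix InnerProductSpace ComplexConjugate ContinuousMap
open Filter Set Function TopologicalSpace MeasureTheory

attribute [summit_statement] _root_.YangMills
attribute [summit_statement] _root_.Summit.QuantumFields.YangMills.Theorems.WeakCouplingRates.XiPowSU2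

/-- item stmt-QuantumFields-22201 · crux · rank 2 · closed · moot by None · by planner
why it might fail: one perturbative unit only if box⁴·β^(−1/2) ≪ 1 (ε < 1/32); a strained boundary layer (exterior only near-pure-gauge) may shift the flux–flux covariance at scale R by more than relative β^(−ε); perimeter R⁵/β² vs collective R⁶/β² is only a 1/R margin.
sources: doi:10.1016/0370-2693(81)90037-x, ChatterjeeYMProb2019, doi:10.1017/cbo9780511470783
[crux] (T) for every compact simple G and faithful unitary r there are ε, κ ∈ (0,1), q, C, β₀ such
that for β ≥ β₀ and every exterior η whose DLR kernel on the box of half-side ⌈β^(4ε)⌉ gives the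
cold event (all plaquettes touching the box cost ≤ β^(κ−1)) probability ≥ 1/2, the cold-conditioned
kernel ν satisfies β^(−q) ≤ Var_ν F and ∫ (F∘α₂ − F)² dν ≤ C β^(−ε) Var_ν F for the cube-smeared R×R
soft-loop observable F, R = ⌈β^ε⌉. [difficulty: L] -/
@[route_item "route-QuantumFields-SoftLoopVariational", crux]
def ColdBoxSoftLoopRatio : Prop :=
  ∀ (G : Type) [Group G] [TopologicalSpace G] [IsTopologicalGroup G] [CompactSpace G] [MeasurableSpace G] [BorelSpace G], Literature.MathematicalPhysics.QuantumFieldTheory.IsCompactSimpleLieGroup G → ∀ r : Literature.MathematicalPhysics.QuantumFieldTheory.LatticeRep G, ∃ ε κ q C β₀ : ℝ, 0 < ε ∧ 0 < κ ∧ κ < 1 ∧ 0 < C ∧ ∀ β : ℝ, β₀ ≤ β → ∀ η : Literature.MathematicalPhysics.QuantumLattice.LGConfig 4 G, let R : ℕ := ⌈β ^ ε⌉₊; let n : ℕ := ⌈β ^ (4 * ε)⌉₊; let Λ : Finset (Literature.MathematicalPhysics.QuantumLattice.ZdEdge 4) := (Literature.Probability.LatticeModels.box 4 n) ×ˢ Finset.univ;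 let cold : Set (Literature.MathematicalPhysics.QuantumLattice.LGConfig 4 G) := {U | ∀ p ∈ Literature.MathematicalPhysics.QuantumLattice.plaquettesTouching Λ, (r.N : ℝ) - Literature.MathematicalPhysics.QuantumLattice.plaquetteObs r.ρ p.1 p.2.1.1 p.2.1.2 U ≤ β ^ (κ - 1)}; let γ : Measure (Literature.MathematicalPhysics.QuantumLattice.LGConfig 4 G) := Literature.MathematicalPhysics.QuantumLattice.ymSpecification (d := 4) r.ρ β Λ η; let ν : Measure (Literature.MathematicalPhysics.QuantumLattice.LGConfig 4 G) := ProbabilityTheory.cond γ cold; let F : Literature.MathematicalPhysics.QuantumLattice.LGConfig 4 G → ℝ := fun U => ∑ x ∈ (Literature.Probability.LatticeModels.box 4 R).filter (fun x => x 0 = 0), Literature.MathematicalPhysics.QuantumLattice.wilsonLoopObs (fun g : G => (r.N : ℝ)⁻¹ * (r.ρ g).trace.re) (Literature.MathematicalPhysics.QuantumLattice.rectWalk x 1 2 R R) U; (2 : ENNReal)⁻¹ ≤ γ cold → β ^ (-q) ≤ ProbabilityTheory.variance F ν ∧ ∫ U, (F (Summit.QuantumFields.YangMills.Theorems.WeakCouplingRates.timeShiftLG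 (G := G) 2 U) - F U) ^ 2 ∂ν ≤ C * β ^ (-ε) * ProbabilityTheory.variance F ν

/-- item stmt-QuantumFields-22202 · crux · rank 3 · closed · moot by None · by planner
why it might fail: needs cold-event typicality UNIFORM over torus-limit states (chessboard plaquette moments passed to weak limits for a closed cylinder event) and exact time-translation invariance of every limit point; junk e^(−cβ^κ)·poly(β) vs floor β^(−q) fails if q must grow with 1/κ.
sources: ChatterjeeYMProb2019, doi:10.1214/24-aop1702, FILS1978
[crux] (K_red) T ⇒ for every compact simple G, faithful r, there are ε, β₀ with: for β ≥ β₀ and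
every torus-limit state μ at coupling β, 0 < rpCorr μ F 2 and rpCorr μ F 0 ≤ exp(2β^(−ε)) · rpCorr μ
F 2 for the same soft-loop observable F (R = ⌈β^ε⌉) — via DLR for limit points, the law of total
variance over the exterior, chessboard typicality of the cold event and time-translation invariance
of torus-limit states. [deps: ColdBoxSoftLoopRatio] [difficulty: M] -/
@[route_item "route-QuantumFields-SoftLoopVariational", crux]
def SoftLoopRatioOfColdBox : Prop :=
  ColdBoxSoftLoopRatio → ∀ (G : Type) [Group G] [TopologicalSpace G] [IsTopologicalGroup G] [CompactSpace G] [MeasurableSpace G] [BorelSpace G], Literature.MathematicalPhysics.QuantumFieldTheory.IsCompactSimpleLieGroup G → ∀ r : Literature.MathematicalPhysics.QuantumFieldTheory.LatticeRep G, ∃ ε β₀ : ℝ, 0 < ε ∧ ∀ β : ℝ, β₀ ≤ β → ∀ μ ∈ Literature.MathematicalPhysics.QuantumLattice.infiniteVolumeLimitPoints (d := 4) r.ρ β, let R : ℕ := ⌈β ^ ε⌉₊; let F : Literature.MathematicalPhysics.QuantumLattice.LGConfig 4 G → ℝ := fun U => ∑ x ∈ (Literature.Probability.LatticeModels.box 4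 R).filter (fun x => x 0 = 0), Literature.MathematicalPhysics.QuantumLattice.wilsonLoopObs (fun g : G => (r.N : ℝ)⁻¹ * (r.ρ g).trace.re) (Literature.MathematicalPhysics.QuantumLattice.rectWalk x 1 2 R R) U; 0 < Summit.QuantumFields.YangMills.Theorems.WeakCouplingRates.rpCorr μ F 2 ∧ Summit.QuantumFields.YangMills.Theorems.WeakCouplingRates.rpCorr μ F 0 ≤ Real.exp (2 * β ^ (-ε)) * Summit.QuantumFields.YangMills.Theorems.WeakCouplingRates.rpCorr μ F 2

/-- item stmt-QuantumFields-22203 · support · rank 9 · closed · proved by Summit.QuantumFields.YangMills.Theorems.SoftLoopLongLag.softLoopObsPosTime_proof (prover) · by planner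
sources: Seiler1982
[support] (P) for every G, r, R the cube-smeared R×R spatial soft-loop observable based in the
time-zero slice is a positive-time observable (bounded continuous cylinder function on edges with x₀
≥ 0): continuity of `walkHolonomy`/`wilsonLoopObs`, |χ| ≤ 1 for the normalised character of a
unitary representation, cylinder on the edges of `rectWalk x 1 2 R R` (all at time x₀ = 0).
[difficulty: provable-now] -/
@[route_item "route-QuantumFields-SoftLoopVariational", crux]
def SoftLoopObsPosTime : Prop :=
  ∀ (G : Type) [Group G] [TopologicalSpace G] [IsTopologicalGroup G] [CompactSpace G] [MeasurableSpace G] [BorelSpace G], ∀ r : Literature.MathematicalPhysics.QuantumFieldTheory.LatticeRep G, ∀ R : ℕ, Summit.QuantumFields.YangMills.Theorems.WeakCouplingRates.IsPosTimeObs (d := 4) (fun U : Literature.MathematicalPhysics.QuantumLattice.LGConfig 4 G => ∑ x ∈ (Literature.Probability.LatticeModels.box 4 R).filter (fun x => x 0 = 0), Literature.MathematicalPhysics.QuantumLattice.wilsonLoopObs (fun g : G => (r.N : ℝ)⁻¹ * (r.ρ g).trace.re) (Literature.MathematicalPhysics.QuantumLattice.rectWalk x 1 2 R R) U)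

/-- `SoftLoopObsPosTime` holds: proved by `Summit.QuantumFields.YangMills.Theorems.SoftLoopLongLag.softLoopObsPosTime_proof`. -/
theorem SoftLoopObsPosTime_holds : SoftLoopObsPosTime := _root_.Summit.QuantumFields.YangMills.Theorems.SoftLoopLongLag.softLoopObsPosTime_proof

/-- item stmt-QuantumFields-22204 · crux (kind.auto-crux: conjecture-grade) · rank 1 · closed · moot by None · by planner
why it might fail: auto-crux — conjecture-grade statement (statement references the registered conjecture Summit.QuantumFields.YangMills.Theorems.WeakCouplingRates.XiPow); it is open, so it may simply be false
sources: ChatterjeeYMProb2019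
[assembly] T → K_red → P → XiPow (all compact simple G); provable now (proof above, kernel-checked
in Sketch.lean). -/
@[route_item "route-QuantumFields-SoftLoopVariational", crux]
def Assembly : Prop :=
  ColdBoxSoftLoopRatio → SoftLoopRatioOfColdBox → SoftLoopObsPosTime → Summit.QuantumFields.YangMills.Theorems.WeakCouplingRates.XiPow

/-! D-0027 §2.1 — DECIDING THEOREM (planner-authored via `route open/edit --closes-file`; by planner-ym-idea-5-g0-0 2026-08-27T20:36:18Z):
its hypotheses are this route's items and its conclusion the registered leaf `Summit.QuantumFields.YangMills.Theorems.WeakCouplingRates.XiPowSU2` (rung R2xi, D-0061) (glue_lint), and it elaborates with this file. -/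

@[closes "route-QuantumFields-SoftLoopVariational"] theorem closes (hA : Summit.QuantumFields.YangMills.Theses.SoftLoopVariational.Assembly)
    (hT : Summit.QuantumFields.YangMills.Theses.SoftLoopVariational.ColdBoxSoftLoopRatio)
    (hK : Summit.QuantumFields.YangMills.Theses.SoftLoopVariational.SoftLoopRatioOfColdBox)
    (hP : Summit.QuantumFields.YangMills.Theses.SoftLoopVariational.SoftLoopObsPosTime) :
    Summit.QuantumFields.YangMills.Theorems.WeakCouplingRates.XiPowSU2 :=
  -- HONEST LABEL: rung R2ξ (SU(2)) is closed in tree (`xiPowSU2_holds`); the content of this line is the OPEN all-G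
  -- leaf `XiPow` = `hA hT hK hP` (Assembly is provable now: `HasRPTimeGap.le_log_div` at t = 2, kernel-checked in the
  -- seat's Sketch.lean as `assembly_holds`), specialised by the tree's `xiPowSU2_of_xiPow`.
  Summit.QuantumFields.YangMills.Theorems.WeakCouplingRates.xiPowSU2_of_xiPow (hA hT hK hP)

end Summit.QuantumFields.YangMills.Theses.SoftLoopVariational
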